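import Summits.ResolutionOfSingularities.ResolutionOfSingularities.Theorems.WeightedInvariantIotaOrdEpsTauUpperSemicontinuousLE
import Summits.ResolutionOfSingularities.ResolutionOfSingularities.Theorems.WeightedInvariantAQSBaseChangeLexMax
import Summits.ResolutionOfSingularities.ResolutionOfSingularities.Theorems.WeightedInvariantAQSBaseChangeResidueField
import Summits.ResolutionOfSingularities.ResolutionOfSingularities.Theorems.WeightedInvariantAQSBaseChangeSquare
import Summits.ResolutionOfSingularities.ResolutionOfSingularities.Theorems.WeightedInvariantIota3EpsStratumMap
import Summits.ResolutionOfSingularities.ResolutionOfSingularities.Theorems.WeightedInvariantIota3EpsEssSmooth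
import Summits.ResolutionOfSingularities.ResolutionOfSingularities.Theorems.WeightedInvariantContactCylinderEssSmooth
import Summits.ResolutionOfSingularities.ResolutionOfSingularities.Theorems.WeightedInvariantEssSmoothDimensionLETwo
import Summits.ResolutionOfSingularities.ResolutionOfSingularities.Theorems.WeightedInvariantIota3TauStrat
import Literature.AlgebraicGeometry.Resolution.WeightedQuasiRegularRelative
import Literature.AlgebraicGeometry.Resolution.OrderFlatLocalHom
import HarnessLib

/-!
# (c11τ)≤3, ASCENT HALF AT EQUAL DIMENSION THREE: a tie position ASCENDS along every local, formally smooth, essentially-of-finite-type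
# homomorphism of regular local rings into dimension `≤ 3` (door `HypersurfaceCentreConstruction`, stmt-ResolutionOfSingularities-19897;
# P3 rung `stub_keyRungGrHomLE_three`, the τ-clause (c11τ)≤3 behind the gaps hc10 / hc11)

Topic: `Summits/ResolutionOfSingularities/ResolutionOfSingularities/Theorems`. Helper for the door item `HypersurfaceCentreConstruction`
(stmt-ResolutionOfSingularities-19897, route `WeightedInvariant`), line `local-engine`, def-free.  The τ-content of the gaps hc10 and hc11 of
`keyRungGrHomLE_three_of_residue_at_powers'` is the ONE clause (c11τ)≤3 «`τ(S', φ f) = τ(S, f)` along local formally smooth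
essentially-of-finite-type `φ : S → S'` of regular local rings with `dim S' ≤ 3`» (…IotaFlatTTorusFactorOfTauEssSmooth).  THIS FILE proves its
ASCENT half at equal dimension: **`Iota3.isTiePosition_map_of_essSmooth`** — if `(S, f)` is a tie position and `dim S' ≤ 3` then
`(S', φ f)` is a tie position — and the inequality **`Iota3.iotaTau_le_iotaTau_map_of_essSmooth : τ(S, f) ≤ τ(S', φ f)`** (`dim S' ≤ 3`).
Every brick is in the tree: `dim S' = dim S = 3` and `𝔪_S S' = 𝔪_{S'}` (`EssSmoothLE2.exists_dims`,
`AQSBaseChange.map_maximalIdeal_eq_of_formallySmooth_of_ringKrullDim_eq`); `ε` is kept (`iotaEps_essSmooth_eq`); the generic prime of the top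
`(ν ; ε)`-stratum extends, with regular quotient (`topStratumPrime_iotaOrdEps_map_eq`); the regular system of parameters `(x, y, z)` maps to one, so
`dim S' ⧸ (φ x, φ y) = 1` (`ringKrullDim_quotient_span_pair`); the tie membership extends generator by generator (`map_weightedMonomialIdeal_three`);
and the lex-maximal Abramovich–Quek–Schober datum `(y, x; r, q; rν)` ascends along the localised homomorphism `S_{(x,y)} → S'_{(φx, φy)}`
(`AQSBaseChange.isLexMaxWeightedCentreGerm_map`), whose residue field extension is formally smooth
(`AQSBaseChange.formallySmooth_residueField_of_map_maximalIdeal_eq`) hence relatively `p`-radically closed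
(`AQSBaseChange.mem_range_algebraMap_of_pow_mem`).  The DESCENT half and the «no tie over a base of dimension `≤ 2`» case remain open.
[OURS · L1 W4.3 · (c11τ)≤3 ascent]  Replaces the role of NO printed item; NOT a statement of the manuscript under review
[claim: Hironaka2017, status: under-review]; candidates stay candidates; AI work, weaker than expert review.  No definition; no axiom.

## References

* D. Abramovich, M. H. Quek, B. Schober, arXiv:2507.01232 (2025), Thm 1.3 (1), Thm 3.5 (stability of the centre under separable base
  change). [AbramovichQuekSchober2025]
* H. Matsumura, *Commutative Ring Theory* (1986), Thm. 14.2, Thm. 15.1, Thm. 23.7, Thm. 26.9. [Matsumura1987]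
-/

noncomputable section

set_option linter.dupNamespace false -- mandated namespace `Summit.<Summit>.<Problem>` of this single-conjunct summit

open IsLocalRing Literature.AlgebraicGeometry.Resolution
open Summit.ResolutionOfSingularities.ResolutionOfSingularities.Theorems
open Summit.ResolutionOfSingularities.ResolutionOfSingularities.Theorems.ContactCylinder

namespace Summit.ResolutionOfSingularities.ResolutionOfSingularities.Cruxes.HypersurfaceCentreConstruction.LocalEngine

namespace Iota3

section Ascent

variable (S S' : Type) [CommRing S] [CommRing S'] [IsRegularLocalRing S] [IsRegularLocalRing S'] [Algebra S S']
  [IsLocalHom (algebraMap S S')] [Algebra.FormallySmooth S S'] [Algebra.EssFiniteType S S']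

/-- **THE LEX-MAXIMAL DATUM ASCENDS ALONG THE LOCALISED HOMOMORPHISM `S_P → S'_{P S'}`** for a prime `P = (x, y)` of `S` with `S_P` of
dimension two and `(φ x, φ y)` prime: the localised homomorphism is local, flat, formally smooth, essentially of finite type, with `𝔪 ↦ 𝔪`
(so `dim S'_{(φ x, φ y)} = 2`, the closed fibre being the residue field) and formally smooth (hence relatively `p`-radically closed) residue
field extension, so `AQSBaseChange.isLexMaxWeightedCentreGerm_map` applies. [cite: AbramovichQuekSchober2025, Thm 3.5] -/
theorem isLexMaxWeightedCentreGerm_atPrime_map (x y f : S) [(Ideal.span ({x, y} : Set S)).IsPrime]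
    [(Ideal.span ({algebraMap S S' x, algebraMap S S' y} : Set S')).IsPrime]
    (hdimP : ringKrullDim (Localization.AtPrime (Ideal.span ({x, y} : Set S))) = (2 : ℕ))
    {w : Fin 2 → ℕ} {ℓ : ℕ}
    (hlex : IsLexMaxWeightedCentreGerm (Localization.AtPrime (Ideal.span ({x, y} : Set S)))
      (Ideal.span {algebraMap S (Localization.AtPrime (Ideal.span ({x, y} : Set S))) f})
      ![algebraMap S (Localization.AtPrime (Ideal.span ({x, y} : Set S))) y,
        algebraMap S (Localization.AtPrime (Ideal.span ({x, y} : Set S))) x] w ℓ) :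
    IsLexMaxWeightedCentreGerm (Localization.AtPrime (Ideal.span ({algebraMap S S' x, algebraMap S S' y} : Set S')))
      (Ideal.span {algebraMap S' (Localization.AtPrime (Ideal.span ({algebraMap S S' x, algebraMap S S' y} : Set S')))
        (algebraMap S S' f)})
      ![algebraMap S' (Localization.AtPrime (Ideal.span ({algebraMap S S' x, algebraMap S S' y} : Set S'))) (algebraMap S S' y),
        algebraMap S' (Localization.AtPrime (Ideal.span ({algebraMap S S' x, algebraMap S S' y} : Set S'))) (algebraMap S S' x)]
      w ℓ := by
  classical
  set P : Ideal S := Ideal.span ({x, y} : Set S) with hPdef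
  set P' : Ideal S' := Ideal.span ({algebraMap S S' x, algebraMap S S' y} : Set S') with hP'def
  set O := Localization.AtPrime P with hO
  set B := Localization.AtPrime P' with hB
  have hcomap : P'.comap (algebraMap S S') = P := comap_span_pair_map S S' x y
  have hmapP : P.map (algebraMap S S') = P' := by rw [hPdef, map_span_pair]
  -- the localised homomorphism `O → B` and its instance block
  haveI : IsRegularLocalRing O := isRegularLocalRing_localization_atPrime S P
  haveI : IsRegularLocalRing B := isRegularLocalRing_localization_atPrime S' P'
  letI : Algebra O B := (Localization.localRingHom P P' (algebraMap S S') hcomap.symm).toAlgebra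
  haveI : IsScalarTower S O B := IsScalarTower.of_algebraMap_eq fun s => by
    change _ = Localization.localRingHom P P' (algebraMap S S') hcomap.symm (algebraMap S O s)
    rw [Localization.localRingHom_to_map, IsScalarTower.algebraMap_apply S S' B]
  haveI : IsLocalHom (algebraMap O B) := Localization.isLocalHom_localRingHom P P' (algebraMap S S') hcomap.symm
  haveI : Algebra.FormallySmooth S B := Algebra.FormallySmooth.comp S S' B
  haveI : Algebra.EssFiniteType S B := Algebra.EssFiniteType.comp S S' B
  haveI : Algebra.FormallySmooth O B := Algebra.FormallySmooth.localization_base P.primeCompl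
  haveI : Algebra.EssFiniteType O B := Algebra.EssFiniteType.of_comp S O B
  haveI : Module.Flat O B := IotaOrderEssSmooth.flat_of_formallySmooth_of_essFiniteType O B
  haveI : Module.FaithfullyFlat O B := Module.FaithfullyFlat.of_flat_of_isLocalHom
  -- `𝔪_O B = 𝔪_B`
  have h𝔪 : (maximalIdeal O).map (algebraMap O B) = maximalIdeal B := by
    have h1 : maximalIdeal O = P.map (algebraMap S O) := (Localization.AtPrime.map_eq_maximalIdeal).symm
    have h2 : maximalIdeal B = P'.map (algebraMap S' B) := (Localization.AtPrime.map_eq_maximalIdeal).symm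
    rw [h1, h2, Ideal.map_map, ← IsScalarTower.algebraMap_eq S O B, IsScalarTower.algebraMap_eq S S' B, ← Ideal.map_map,
      hmapP]
  -- `dim B = dim O = 2`: the closed fibre `B ⧸ 𝔪_O B = κ(B)` is a field
  have hdimP' : ringKrullDim B = (2 : ℕ) := by
    obtain ⟨a, b, c, ha, hb, hc, hab⟩ := EssSmoothLE2.exists_dims O B
    have ha2 : a = 2 := by
      have h : ((a : ℕ) : WithBot ℕ∞) = (2 : ℕ) := ha.symm.trans hdimP
      exact_mod_cast h
    have hcongr : ∀ (I J : Ideal B), I = J → ringKrullDim (B ⧸ I) = ringKrullDim (B ⧸ J) := by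
      rintro I J rfl; rfl
    have hc0 : c = 0 := by
      have hF : IsField (B ⧸ maximalIdeal B) := (Ideal.Quotient.maximal_ideal_iff_isField_quotient (maximalIdeal B)).mp inferInstance
      have h := (hcongr _ _ h𝔪).symm.trans hc
      rw [ringKrullDim_eq_zero_of_isField hF] at h
      have h' : ((0 : ℕ) : WithBot ℕ∞) = c := by exact_mod_cast h
      exact_mod_cast h'.symm
    rw [hb, hab, ha2, hc0]
  -- the residue field extension is formally smooth, hence relatively `p`-radically closed
  letI := (IsLocalRing.ResidueField.map (algebraMap O B)).toAlgebra
  haveI : Algebra.FormallySmooth (ResidueField O) (ResidueField B) :=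
    AQSBaseChange.formallySmooth_residueField_of_map_maximalIdeal_eq O B h𝔪
  set p := ringExpChar (ResidueField O) with hp
  haveI : ExpChar (ResidueField B) p :=
    expChar_of_injective_ringHom (algebraMap (ResidueField O) (ResidueField B)).injective p
  have hcl : ∀ z : ResidueField B, z ^ p ∈ (IsLocalRing.ResidueField.map (algebraMap O B)).range →
      z ∈ (IsLocalRing.ResidueField.map (algebraMap O B)).range := fun z hz =>
    AQSBaseChange.mem_range_algebraMap_of_pow_mem (E := ResidueField O) (L := ResidueField B) p hz
  -- the datum ascends
  have key := AQSBaseChange.isLexMaxWeightedCentreGerm_map hdimP hdimP' h𝔪 p hcl hlex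
  have hφ : ∀ s : S, algebraMap O B (algebraMap S O s) = algebraMap S' B (algebraMap S S' s) := fun s => by
    rw [← IsScalarTower.algebraMap_apply S O B, IsScalarTower.algebraMap_apply S S' B]
  have hv : (fun i => algebraMap O B ((![algebraMap S O y, algebraMap S O x] : Fin 2 → O) i)) =
      ![algebraMap S' B (algebraMap S S' y), algebraMap S' B (algebraMap S S' x)] := by
    funext i; fin_cases i
    · exact hφ y
    · exact hφ x
  rw [hφ f, hv] at key
  exact key

omit [IsRegularLocalRing S] in
/-- **(c11τ)≤3, ASCENT: A TIE POSITION ASCENDS ALONG ESSENTIALLY SMOOTH LOCAL HOMOMORPHISMS INTO DIMENSION `≤ 3`.**  `φ : S → S'` local,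
formally smooth, essentially of finite type between regular local rings, `dim S' ≤ 3`; if `(S, f)` is a tie position (`Iota3.IsTiePosition`),
so is `(S', φ f)`: the tie presentation `(x, y, z; q, r; λ)` maps to the tie presentation `(φ x, φ y, φ z; q, r; φ λ)`. [OURS · (c11τ)≤3 ascent] -/
theorem isTiePosition_map_of_essSmooth (hdimS' : ringKrullDim S' ≤ 3) {f : S} (htie : IsTiePosition S f) :
    IsTiePosition S' (algebraMap S S' f) := by
  classical
  have htie' := htie
  obtain ⟨_, hdim, heps, -, x, y, z, q, r, lam, hpres⟩ := htie
  obtain ⟨hxyz, hP₀, ν, hP, hfν, hfν1, hlex, hmem⟩ := hpres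
  haveI := hP
  haveI : Module.Flat S S' := IotaOrderEssSmooth.flat_of_formallySmooth_of_essFiniteType S S'
  haveI : Module.FaithfullyFlat S S' := Module.FaithfullyFlat.of_flat_of_isLocalHom
  -- dimensions: `dim S' = dim S = 3`
  obtain ⟨a, b, c, ha, hb, -, hab⟩ := EssSmoothLE2.exists_dims S S'
  have ha3 : a = 3 := by
    have h : ((a : ℕ) : WithBot ℕ∞) = 3 := ha.symm.trans hdim
    exact_mod_cast h
  have hb3 : b = 3 := by
    have h : ((b : ℕ) : WithBot ℕ∞) ≤ 3 := hb ▸ hdimS'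
    have h' : b ≤ 3 := by exact_mod_cast h
    omega
  have hdim' : ringKrullDim S' = 3 := by rw [hb, hb3]; rfl
  have hdimN : ringKrullDim S = (3 : ℕ) := by rw [hdim]; rfl
  have hdimN' : ringKrullDim S' = (3 : ℕ) := by rw [hdim']; rfl
  -- `𝔪_S S' = 𝔪_{S'}`
  have h𝔪 : (maximalIdeal S).map (algebraMap S S') = maximalIdeal S' :=
    AQSBaseChange.map_maximalIdeal_eq_of_formallySmooth_of_ringKrullDim_eq S S' hdimN hdimN'
  -- the equation: `0 ≠ f ∈ 𝔪`, order `ν`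
  have hf0 : f ≠ 0 := IsTiePosition.ne_zero htie'
  have hfm : f ∈ maximalIdeal S := IsTiePosition.mem_maximalIdeal htie'
  have hν : iotaOrd S f = (ν : ℕ) := (iotaOrd_eq_natCast_iff S f ν).mpr ⟨hfν, hfν1⟩
  -- the generic prime of the top `(ν ; ε)`-stratum extends
  obtain ⟨hP₀p, hreg, -, hE, -, -⟩ := topStratumPrime_iotaOrdEps_spec (le_of_eq hdim) hf0 hfm hν
  haveI := hP₀p
  obtain ⟨hP₀'p, -, -, hP₀'⟩ := topStratumPrime_iotaOrdEps_map_eq S S' f hreg hE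
  have hPmap : (topStratumPrime iotaOrdEps S f).map (algebraMap S S') =
      Ideal.span {algebraMap S S' x, algebraMap S S' y} := by rw [hP₀, map_span_pair]
  haveI hP' : (Ideal.span ({algebraMap S S' x, algebraMap S S' y} : Set S')).IsPrime := hPmap ▸ hP₀'p
  have hP₀'' : topStratumPrime iotaOrdEps S' (algebraMap S S' f) = Ideal.span {algebraMap S S' x, algebraMap S S' y} :=
    hP₀'.trans hPmap
  -- the regular system of parameters maps to one
  have hxyz' : Ideal.span {algebraMap S S' x, algebraMap S S' y, algebraMap S S' z} = maximalIdeal S' := by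
    rw [← map_span_triple, hxyz, h𝔪]
  have hsf' : (maximalIdeal S').spanFinrank = 3 := by
    have h := (isRegularLocalRing_iff S').mp inferInstance
    rw [hdim'] at h
    exact_mod_cast h
  -- the curve: `dim S' ⧸ (φ x, φ y) = 1`
  have hq1' : ringKrullDim (S' ⧸ topStratumPrime iotaOrdEps S' (algebraMap S S' f)) = 1 := by
    have h := ringKrullDim_quotient_span_pair (algebraMap S S' x) (algebraMap S S' y) (algebraMap S S' z) hxyz' hsf'
    have hcongr : ∀ (I J : Ideal S'), I = J → ringKrullDim (S' ⧸ I) = ringKrullDim (S' ⧸ J) := by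
      rintro I J rfl; rfl
    rw [hcongr _ _ hP₀'', h]
  -- dimensions two at the curve, downstairs and upstairs
  have hdimP : ringKrullDim (Localization.AtPrime (Ideal.span ({x, y} : Set S))) = (2 : ℕ) := by
    have h2 := TieFinite.IsTiePosition.ringKrullDim_localization_topStratumPrime_eq_two htie'
    rw [← TieFinite.ringKrullDim_atPrime_congr hP₀, h2]; rfl
  -- the lex-maximal datum ascends to `S'_{(φ x, φ y)}`
  have hlex' := isLexMaxWeightedCentreGerm_atPrime_map S S' x y f hdimP hlex
  -- the order is kept
  have hfν' : algebraMap S S' f ∈ maximalIdeal S' ^ ν :=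
    (mem_pow_maximalIdeal_iff_of_map_maximalIdeal_eq h𝔪 ν f).mp hfν
  have hfν1' : algebraMap S S' f ∉ maximalIdeal S' ^ (ν + 1) := fun h =>
    hfν1 ((mem_pow_maximalIdeal_iff_of_map_maximalIdeal_eq h𝔪 (ν + 1) f).mpr h)
  -- the tie membership extends generator by generator
  have hmem' : algebraMap S S' f ∈ weightedMonomialIdeal
      ![algebraMap S S' x, algebraMap S S' y - algebraMap S S' lam * algebraMap S S' x ^ r, algebraMap S S' z]
      ![q, r + 1, 1] ((r + 1) * ν) := by
    have h1 := Ideal.mem_map_of_mem (algebraMap S S') hmem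
    rw [map_weightedMonomialIdeal_three] at h1
    simpa only [map_sub, map_mul, map_pow] using h1
  -- `ε` is kept
  have heps' : iotaEps S' (algebraMap S S' f) = 0 := by rw [iotaEps_essSmooth_eq S S' f]; exact heps
  exact ⟨inferInstance, hdim', heps', hq1', algebraMap S S' x, algebraMap S S' y, algebraMap S S' z, q, r, algebraMap S S' lam,
    hxyz', hP₀'', ν, hP', hfν', hfν1', hlex', hmem'⟩

/-- **`τ` DOES NOT DROP along essentially smooth local homomorphisms into dimension `≤ 3`**: `τ(S, f) ≤ τ(S', φ f)` — the ascent half of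
(c11τ)≤3 in the clause's binder shape (at `dim S' ≤ 3` the bit `τ` is the raw tie bit). [OURS · (c11τ)≤3 ascent] -/
theorem iotaTau_le_iotaTau_map_of_essSmooth (hdimS' : ringKrullDim S' ≤ 3) (f : S) :
    iotaTau S f ≤ iotaTau S' (algebraMap S S' f) := by
  rcases iotaTau_eq_zero_or_eq_one S f with h0 | h1
  · rw [h0]; exact zero_le
  · -- `dim S ≤ dim S' ≤ 3`, so `τ(S) = 1` means `S` itself is a tie position
    obtain ⟨a, b, c, ha, hb, -, hab⟩ := EssSmoothLE2.exists_dims S S'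
    have hdimS : ringKrullDim S ≤ 3 := by
      have h : ((b : ℕ) : WithBot ℕ∞) ≤ 3 := hb ▸ hdimS'
      have hb3 : b ≤ 3 := by exact_mod_cast h
      rw [ha]; exact_mod_cast (show a ≤ 3 by omega)
    have htie : IsTiePosition S f := (iotaTau_eq_one_iff_isTiePosition hdimS f).mp h1
    rw [h1, iotaTau_of_isTiePosition (isTiePosition_map_of_essSmooth S S' hdimS' htie)]

end Ascent

end Iota3

end Summit.ResolutionOfSingularities.ResolutionOfSingularities.Cruxes.HypersurfaceCentreConstruction.LocalEngine

end
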